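/-
# `Balaban1983to89.B5SupRepTorus` — Bałaban CMP 95 (1984), Proposition 1.2, step S1 AS PRINTED on the torus of record:
# the leaf (1.128) in its PRINTED sup currency ON THE SUP CARRIER OF RECORD, and the direct representation
# `B5SupWalkS1.Rep` of `G = Δ_a⁻¹` INHABITED

statement-level skeleton of published theorems with citation tags; proofs where landed; nothing here is a claim
about the Yang–Mills mass gap

CITATION HEADER (lean-in-tree rule).  Cell `lit-balaban`, unit `lit-balaban-r02` (reader/typer r02 gen 11 = fold owner of block B5),
HOME `run/shared/lean/pub/lit-balaban/` (SKELETON rows B5.Eq1.128 / B5.Eq1.121 / B5.Eq1.123 / B5.Prop1.2 cells; S1-torus programme =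
`lit-balaban-r02/B5-CLOSURE.md` §5 item 2, r02's part of the r02 ∕ p38-gen-8 split recorded in HOME/STATUS.md 2026-08-22T03:18–03:35Z).
B5 = T. Bałaban, *Propagators and renormalization transformations for lattice gauge theories. I*, Commun. Math. Phys. **95** (1984)
17–40 [`Balaban1984PropagatorsI`], held as `paper:balaban1984-cmp95-propagators-rt-i` (pp. 35–39 = text layer p0019–p0023).  FILE 3 of
r02's files: file 1 `B5SupCommutator128` (p315722: the abstract `ℓ^∞` schema `h128_schemaS`), file 2 `B5SupH128Torus` (p316284: (1.128)
on the GRADED sup carrier `Idx n M → ℝ`); p38 gen 8's FILE A `B5SupCarrierTorus` (p316435) fixed the carriers of record of the walk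
problems: real vector fields `VecR n M = (T_η × {1..d}) → ℝ` with Mathlib's sup norm (= `|A|` of (1.108)) and the operators `Gs`
(`G`), `DAs` (`Δ_a`), `Hs z` (`h_z`), `Dgs` (`∇`), with the fields `h118`, `h71`, `normH`, `h115` of `Rep` proved there.  THIS FILE
supplies the remaining field `h128` on that carrier and assembles the `Rep` of record.

WHAT IS PRINTED.  p. 38 [PDF 22], verbatim: «Defining 2δ₀ = min{⅓δ′₀, M₀⁻¹}, we obtain |h_{z₁}K(h_{z₂})A| ≤ O(M₀⁻¹)e^{−2δ₀|z₁−z₂|}(|∇A| +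
|A|). (1.128)»; p. 37 [PDF 21] (1.121) (the computation of `K(h) = hΔ_a − Δ_a h`) and (1.123) (the random-walk expansion
`h_zGh_zA = Σ_ω …`); p. 36 (1.115), (1.118); p. 30 (1.71).

WHAT THIS MODULE PROVES (kernel-checked, zero sorry; uniform in `η = n⁻¹`, the volume and `M₀ ≥ 1`):
§1 EXTENSION BY ZERO `extS v : Idx n M → ℝ` of a vector field to the graded carrier of file 2 (vector slice `Sum.inl ()` = `v`, tensor
   slices `0`): `slS (extS v) (inl ()) = v`, `‖extS v‖ ≤ ‖v‖`, `‖DgS (extS v)‖ ≤ ‖Dgs v‖` — the device by which the graded estimates of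
   file 2 are READ on the carrier of record (nothing is re-estimated);
§2 the (1.121) local bound ON THE CARRIER OF RECORD: `comm_plain_apply` (the commutator of `mulOpS g` with `kerOpS T` is p38's `commR`),
   `abs_commR_Lloc_plain_le`, **`local_normP_holds`**: `‖[h_z, Δ + aQ*Q]v‖_∞ ≤ ℓ₁(‖Dgs v‖ + ‖v‖)`, `ℓ₁ = (2dLw + dK2 + 4|a|Lw)/M₀ = O(M₀⁻¹)`;
§3 `schemaP_holds` (file 1's `SchemaS` on `ι = T_η × {1..d}`: profiles `hcoefS`, centres `ctr`, local part `Lloc = Δ + aQ*Q`, kernel part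
   `kmat = −re ∂P∂*`, size map `Dgs`, row sums `d·η^{−d}e^{δ/4}K_d(δ/8)` from p37's `fineRowSum_le`) and **`h128P_holds`** = THE FIELD
   `Rep.h128` FOR THE OPERATORS OF RECORD: given ‖(∂P∂*)_{ij}‖ ≤ Cη^d e^{−δ|x_i−x_j|},
   `‖Hs z₁ (Kop DAs Hs z₂ v)‖ ≤ (thetaW d a δ C/M₀)·e^{−twoDelta0 δ M₀·dist(ctr z₁, ctr z₂)}·(‖Dgs v‖ + ‖v‖)` (p38's constant `thetaW`;
   the plain row sum lacks the factor `|Gr d| ≥ 1` of the graded one, so the same constant dominates);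
§4 **`repS`** — `B5SupWalkS1.Rep (latticeSettingP12R n M a k) (kdW n M) (gP12R M n a k) M₀ κ (VecR n M) (Fin d → VecR n M) (TorR M)
   (Cen M M₀) (ctr M M₀)` INHABITED for every `n ≥ 1`, torus `M`, `a > 0`, `k`, `M₀ ≥ 1` and every `κ : SupConsts` with
   `thetaW d a ≤ κ.thetaBar` (on `δ > 0`, `C ≥ 0`) and `1 ≤ κ.cG`: fields `G, Δa, H, Dg, h118, h71, h71', normH, h115` = p38's FILE A,
   `h128` = §3 ∘ p38's `entry_le_of_kdW`; `thetaBarS d a` = a total majorant of `thetaW d a` usable as `κ.thetaBar`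
   (`thetaBarS_nonneg`, `thetaW_le_thetaBarS`, `repS_thetaBarS`) — the geometric/certificate slots of `κ` are fixed by the certificate files.

HONEST SCOPE.  (1) As files 1–2: (1.126) enters `h128` as the HYPOTHESIS of `Rep.h128` on the kernel datum `kdW` (p16's theorem
discharges it where `SupRealisation` is consumed); constants ours («O(M₀⁻¹)» made explicit); rate `2δ₀ = min{⅓δ′₀, M₀⁻¹}` exact.  (2) `Rep`
is ONE slot of `B5SupWalkS1.SupRealisation`; the domination certificates (1.125)/(1.129)/(1.130) and the adjoint representation (p. 39)
are p38 gen 8's files B–E; the capstone `s1_of_walks` needs all of them.  Value = the direct representation of the printed sup walk for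
`Δ_a` of record available to the certificate files, NOT summit progress.
-/
import Mathlib
import Literature.MathematicalPhysics.QuantumFieldTheory.Balaban1983to89.B5SupH128Torus
import Literature.MathematicalPhysics.QuantumFieldTheory.Balaban1983to89.B5SupCarrierTorus
import Literature.MathematicalPhysics.QuantumFieldTheory.Balaban1983to89.B5SupWalkS1
import Literature.MathematicalPhysics.QuantumFieldTheory.Balaban1983to89.B5WalkRealisationTorus

open scoped BigOperators Real Matrix
open Finset Matrix

namespace Literature.MathematicalPhysics.QuantumFieldTheory.Balaban1983to89.B5SupRepTorus

open Literature.MathematicalPhysics.QuantumFieldTheory.Balaban1983to89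
open Literature.MathematicalPhysics.QuantumFieldTheory.Balaban1983to89.B5Prop11Plancherel (Tor fine)
open Literature.MathematicalPhysics.QuantumFieldTheory.Balaban1983to89.B5Prop12FieldsLattice (distU)
open Literature.MathematicalPhysics.QuantumFieldTheory.Balaban1983to89.B5Walk131 (twoDelta0)
open Literature.MathematicalPhysics.QuantumFieldTheory.Balaban1983to89.B5CombesThomasLattice (fineRowSum_le)
open Literature.MathematicalPhysics.QuantumFieldTheory.Balaban1983to89.B5CoverP12Lattice (Lw Lw_nonneg)
open Literature.MathematicalPhysics.QuantumFieldTheory.Balaban1983to89.B5Local114 (Kop)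
open Literature.MathematicalPhysics.QuantumFieldTheory.Balaban1983to89.B5RealFields (fdiffR DeltaAR)
open Literature.MathematicalPhysics.QuantumFieldTheory.Balaban1983to89.B5SettingP12Real (VecR latticeSettingP12R gP12R)
open Literature.MathematicalPhysics.QuantumFieldTheory.Balaban1983to89.B5WalkTorusGeom (TorR ucPt Cen ctr)
open Literature.MathematicalPhysics.QuantumFieldTheory.Balaban1983to89.B5WalkPartitionTorus (hz abs_hz_sub_le
  dist_ctr_le_of_hz_ne_zero)
open Literature.MathematicalPhysics.QuantumFieldTheory.Balaban1983to89.B5WalkCarrierTorus (Gr Bnd Idx)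
open Literature.MathematicalPhysics.QuantumFieldTheory.Balaban1983to89.B5WalkH128Torus (gz K2 K2_nonneg commR commR_apply Lloc
  distU_le_of_Lloc_ne_zero VC kmat abs_kmat_le thetaW thetaW_nonneg DeltaAR_eq_Lloc_add_kmat dist_ucPt_eq_distU)
open Literature.MathematicalPhysics.QuantumFieldTheory.Balaban1983to89.B5WalkRealisationTorus (kdW entry_le_of_kdW)
open Literature.MathematicalPhysics.QuantumFieldTheory.Balaban1983to89.B5SupWalk131 (SupConsts)
open Literature.MathematicalPhysics.QuantumFieldTheory.Balaban1983to89.B5SupWalkS1 (Rep)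
open Literature.MathematicalPhysics.QuantumFieldTheory.Balaban1983to89.B5SupCommutator128 (kerOpS kerOpS_apply mulOpS mulOpS_apply
  abs_apply_le_norm SchemaS h128_schemaS)
open Literature.MathematicalPhysics.QuantumFieldTheory.Balaban1983to89.B5SupH128Torus (slS slS_apply DgS DgS_apply abs_commR_Lloc_le)
open Literature.MathematicalPhysics.QuantumFieldTheory.Balaban1983to89.B5SupCarrierTorus (hcoefS Hs Gs DAs Dgs Hs_eq Dgs_apply
  abs_hcoefS_le_one DAs_eq_kerOpS_add DAs_mul_Gs Gs_mul_DAs h118S norm_Hs_le h115S_holds)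

noncomputable section

variable {d : ℕ}

/-! ## §1 Extension by zero to the vector slice of the graded carrier -/

section Extension

variable (n : ℕ) [NeZero n] (M : Fin d → ℕ) [hM : ∀ μ, NeZero (M μ)]

/-- **extension by zero**: the graded section of file 2's carrier whose vector slice (`Sum.inl ()`) is the vector field `v` and whose
tensor slices vanish. [cite: Balaban1984PropagatorsI, (1.123) p.37 (G, h_z, K(h_z) act on vector functions A)] -/
def extS (v : VecR n M) : Idx n M → ℝ := fun p => if p.2 = Sum.inl () then v p.1 else 0

variable {n M}

omit [NeZero n] hM in
/-- the vector slice of the extension is `v`. [cite: Balaban1984PropagatorsI, (1.123) p.37] -/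
theorem slS_extS_inl (v : VecR n M) : slS n M (extS n M v) (Sum.inl ()) = v := by
  funext b
  simp [slS, extS]

omit [NeZero n] hM in
/-- the tensor slices of the extension vanish. [cite: Balaban1984PropagatorsI, (1.123) p.37] -/
theorem slS_extS_of_ne (v : VecR n M) {r : Gr d} (hr : r ≠ Sum.inl ()) : slS n M (extS n M v) r = 0 := by
  funext b
  simp [slS, extS, hr]

/-- `‖extS v‖ ≤ ‖v‖`. [cite: Balaban1984PropagatorsI, (1.108) p.35 (|A| = max_μ sup_x |A_μ(x)|)] -/
theorem norm_extS_le (v : VecR n M) : ‖extS n M v‖ ≤ ‖v‖ := by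
  refine (pi_norm_le_iff_of_nonneg (norm_nonneg v)).mpr fun p => ?_
  rw [Real.norm_eq_abs]
  unfold extS
  split_ifs with h
  · exact abs_apply_le_norm v p.1
  · rw [abs_zero]; exact norm_nonneg v

/-- every forward difference is bounded by `|∇A|`: `|(∇_ν v)(b)| ≤ ‖Dgs v‖`. [cite: Balaban1984PropagatorsI, (1.108) p.35 (|∇A|)] -/
theorem abs_fdiffR_le_norm_Dgs (v : VecR n M) (ν : Fin d) (b : Bnd n M) : |(fdiffR n M ν *ᵥ v) b| ≤ ‖Dgs n M v‖ := by
  rw [← Dgs_apply, ← Real.norm_eq_abs]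
  exact (norm_le_pi_norm (Dgs n M v ν) b).trans (norm_le_pi_norm (Dgs n M v) ν)

/-- `‖DgS (extS v)‖ ≤ ‖Dgs v‖` (the graded gradient of the extension is the extension of the gradient).
[cite: Balaban1984PropagatorsI, (1.108) p.35 (|∇A| = max_{μ,ν} sup_x |(∂_μA_ν)(x)|)] -/
theorem norm_DgS_extS_le (v : VecR n M) : ‖DgS n M (extS n M v)‖ ≤ ‖Dgs n M v‖ := by
  refine (pi_norm_le_iff_of_nonneg (norm_nonneg _)).mpr fun q => ?_
  obtain ⟨⟨b, r⟩, ν⟩ := q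
  rw [Real.norm_eq_abs, DgS_apply]
  show |(fdiffR n M ν *ᵥ slS n M (extS n M v) r) b| ≤ ‖Dgs n M v‖
  by_cases hr : r = Sum.inl ()
  · subst hr
    rw [slS_extS_inl]
    exact abs_fdiffR_le_norm_Dgs v ν b
  · rw [slS_extS_of_ne v hr, Matrix.mulVec_zero, Pi.zero_apply, abs_zero]
    exact norm_nonneg _

end Extension

/-! ## §2 The (1.121) local bound on the carrier of record -/

section Local

variable {n : ℕ} [NeZero n] {M : Fin d → ℕ} [hM : ∀ μ, NeZero (M μ)] {M₀ : ℕ} {a : ℝ}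

omit [NeZero n] hM in
/-- p38 gen 8's multiplier profile `hcoefS` IS p38 gen 7's `gz` (`h_z` evaluated at the site of the bond); private here (p38's FILE B
exports the `simp` form). [cite: Balaban1984PropagatorsI, (1.118) p.36] -/
private theorem hcoefS_eq_gz (z : Cen M M₀) : hcoefS n M M₀ z = gz n M M₀ z := rfl

/-- **the commutator of a multiplier with a kernel operator on the carrier of record, componentwise**, is p38's real commutator:
`((mulOpS g * kerOpS T − kerOpS T * mulOpS g) v)(b) = commR g T v b`. [cite: Balaban1984PropagatorsI, (1.121) p.37 (K(h) = hΔ_a − Δ_a h)] -/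
theorem comm_plain_apply (g : VecR n M) (T : Matrix (Bnd n M) (Bnd n M) ℝ) (v : VecR n M) (b : Bnd n M) :
    (mulOpS g * kerOpS (fun i j => T i j) - kerOpS (fun i j => T i j) * mulOpS g) v b = commR g T v b := by
  rw [LinearMap.sub_apply, Pi.sub_apply, Module.End.mul_apply, Module.End.mul_apply, mulOpS_apply, kerOpS_apply, kerOpS_apply,
    commR_apply]
  rfl

/-- **THE LOCAL BOUND (1.121) FOR `Δ + aQ*Q` ON THE CARRIER OF RECORD, POINTWISE**: `|[h_z, Δ + aQ*Q]v (b)| ≤ c₁‖Dgs v‖ + c₂‖v‖`,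
`c₁ = 2dLw/M₀`, `c₂ = dK2/M₀² + 4|a|Lw/M₀` — file 2's graded `abs_commR_Lloc_le` read on the vector slice of `extS v`.
[cite: Balaban1984PropagatorsI, (1.121) p.37, (1.128) p.38] -/
theorem abs_commR_Lloc_plain_le (hn : 1 ≤ n) (hM₀ : 1 ≤ M₀) (z : Cen M M₀) (v : VecR n M) (b : Bnd n M) :
    |commR (hcoefS n M M₀ z) (Lloc n M a) v b|
      ≤ d * (2 * (Lw d / M₀)) * ‖Dgs n M v‖ + (d * (K2 / (M₀ : ℝ) ^ 2) + |a| * (4 * (Lw d / M₀))) * ‖v‖ := by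
  have h := abs_commR_Lloc_le (a := a) hn hM₀ z (extS n M v) (Sum.inl ()) b
  rw [slS_extS_inl] at h
  rw [hcoefS_eq_gz]
  have hLw := Lw_nonneg d
  have hK2 := K2_nonneg
  have h1 : 0 ≤ d * (2 * (Lw d / (M₀ : ℝ))) := by positivity
  have h2 : 0 ≤ d * (K2 / (M₀ : ℝ) ^ 2) + |a| * (4 * (Lw d / M₀)) := by positivity
  exact h.trans (add_le_add (mul_le_mul_of_nonneg_left (norm_DgS_extS_le v) h1) (mul_le_mul_of_nonneg_left (norm_extS_le v) h2))

/-- **THE FIELD `SchemaS.local_norm` ON THE CARRIER OF RECORD**: `‖[h_z, Δ + aQ*Q]v‖_∞ ≤ ℓ₁(‖Dgs v‖ + ‖v‖)`,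
`ℓ₁ = (2dLw + dK2 + 4|a|Lw)/M₀ = O(M₀⁻¹)` uniformly in `η` (same constant as file 2's graded `local_normS_holds` and p38's `L²`
`local_norm_holds`). [cite: Balaban1984PropagatorsI, (1.121) p.37, (1.128) p.38 («the small factor O(M₀⁻¹) only»)] -/
theorem local_normP_holds (hn : 1 ≤ n) (hM₀ : 1 ≤ M₀) (z : Cen M M₀) (v : VecR n M) :
    ‖(mulOpS (hcoefS n M M₀ z) * kerOpS (fun i j => Lloc n M a i j)
        - kerOpS (fun i j => Lloc n M a i j) * mulOpS (hcoefS n M M₀ z)) v‖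
      ≤ (2 * d * Lw d + d * K2 + 4 * |a| * Lw d) / M₀ * (‖Dgs n M v‖ + ‖v‖) := by
  have hM0 : (0 : ℝ) < M₀ := by exact_mod_cast hM₀
  have hM1 : (1 : ℝ) ≤ M₀ := by exact_mod_cast hM₀
  have hLw := Lw_nonneg d
  have hK2 := K2_nonneg
  set c₁ : ℝ := d * (2 * (Lw d / M₀)) with hc₁
  set c₂ : ℝ := d * (K2 / (M₀ : ℝ) ^ 2) + |a| * (4 * (Lw d / M₀)) with hc₂
  set ℓ₁ : ℝ := (2 * d * Lw d + d * K2 + 4 * |a| * Lw d) / M₀ with hℓ₁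
  have h1 : c₁ ≤ ℓ₁ := by
    rw [hc₁, hℓ₁, le_div_iff₀ hM0]
    have e : d * (2 * (Lw d / (M₀ : ℝ))) * M₀ = 2 * d * Lw d := by field_simp
    rw [e]
    have : (0 : ℝ) ≤ d * K2 + 4 * |a| * Lw d := by positivity
    linarith
  have h2 : c₂ ≤ ℓ₁ := by
    rw [hc₂, hℓ₁, le_div_iff₀ hM0]
    have e : (d * (K2 / (M₀ : ℝ) ^ 2) + |a| * (4 * (Lw d / M₀))) * M₀ = d * K2 / M₀ + 4 * |a| * Lw d := by
      field_simp
    rw [e]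
    have h3 : d * K2 / (M₀ : ℝ) ≤ d * K2 := div_le_self (by positivity) hM1
    have h4 : (0 : ℝ) ≤ 2 * d * Lw d := by positivity
    linarith
  have hD := norm_nonneg (Dgs n M v)
  have hA := norm_nonneg v
  refine (pi_norm_le_iff_of_nonneg (by positivity)).mpr fun b => ?_
  rw [Real.norm_eq_abs, comm_plain_apply]
  calc _ ≤ c₁ * ‖Dgs n M v‖ + c₂ * ‖v‖ := abs_commR_Lloc_plain_le hn hM₀ z v b
    _ ≤ ℓ₁ * ‖Dgs n M v‖ + ℓ₁ * ‖v‖ := add_le_add (mul_le_mul_of_nonneg_right h1 hD) (mul_le_mul_of_nonneg_right h2 hA)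
    _ = ℓ₁ * (‖Dgs n M v‖ + ‖v‖) := by ring

end Local

/-! ## §3 The schema on the carrier of record and the field `h128` -/

section H128

variable {n : ℕ} [NeZero n] {M : Fin d → ℕ} [hM : ∀ μ, NeZero (M μ)] {a : ℝ}

/-- **uniform row sums on the bond index set** `T_η × {1..d}`: `Σ_{b′} e^{−β|x_b − x_{b′}|} ≤ d·η^{−d}·e^{2β}K_d(β)` (p37's `fineRowSum_le`).
[cite: Balaban1984PropagatorsI, (1.131) p.38 (row sums), (1.126) p.38] -/
theorem rowsum_plain_le (hn : 1 ≤ n) {β : ℝ} (hβ : 0 < β) (b : Bnd n M) :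
    ∑ b' : Bnd n M, Real.exp (-(β * dist (ucPt M n b.1) (ucPt M n b'.1)))
      ≤ d * ((n : ℝ) ^ d * (Real.exp (2 * β) * B4Sect5Proof.latticeConst d β)) := by
  have hn0 : ((n : ℝ) ^ d) ≠ 0 := pow_ne_zero _ (Nat.cast_ne_zero.mpr (NeZero.ne n))
  have hrow := fineRowSum_le n M hn hβ b.1
  have e1 : ∑ b' : Bnd n M, Real.exp (-(β * dist (ucPt M n b.1) (ucPt M n b'.1)))
      = ∑ x : Tor (fine n M), ∑ _μ : Fin d, Real.exp (-(β * distU n M b.1 x)) := by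
    rw [Fintype.sum_prod_type]
    exact Finset.sum_congr rfl fun x _ => Finset.sum_congr rfl fun μ _ => by rw [dist_ucPt_eq_distU hn]
  have e2 : ∑ x : Tor (fine n M), ∑ _μ : Fin d, Real.exp (-(β * distU n M b.1 x))
      = d * ∑ x : Tor (fine n M), Real.exp (-(β * distU n M b.1 x)) := by
    simp only [Finset.sum_const, Finset.card_univ, Fintype.card_fin, nsmul_eq_mul, Finset.mul_sum]
  have e3 : ∑ x : Tor (fine n M), Real.exp (-(β * distU n M b.1 x))
      = (n : ℝ) ^ d * ∑ x : Tor (fine n M), ((n : ℝ) ^ d)⁻¹ * Real.exp (-(β * distU n M b.1 x)) := by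
    rw [Finset.mul_sum]
    exact Finset.sum_congr rfl fun x _ => by rw [← mul_assoc, mul_inv_cancel₀ hn0, one_mul]
  rw [e1, e2, e3]
  have hd : (0 : ℝ) ≤ d := Nat.cast_nonneg _
  gcongr

/-- **file 1's `SchemaS` INSTANTIATED ON THE CARRIER OF RECORD** for `Δ_a` (profiles `hcoefS z b = h_z(x_b)`, centres `ctr`, `s = ⅔M₀`,
`ℓ = Lw/M₀`, `ℓ₁ = (2dLw + dK2 + 4|a|Lw)/M₀`, `ρ = 4`, kernel constant `Cη^d`, row sums `d·η^{−d}e^{δ/4}K_d(δ/8)`, size map `Dgs`).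
[cite: Balaban1984PropagatorsI, (1.121) p.37, (1.126) p.38, (1.128) p.38] -/
theorem schemaP_holds (hn : 1 ≤ n) {M₀ : ℕ} (hM₀ : 1 ≤ M₀) {δ C : ℝ} (hδ : 0 < δ) (hC : 0 ≤ C)
    (hV : ∀ i j : Bnd n M, ‖VC n M i j‖ ≤ C * ((n : ℝ) ^ d)⁻¹ * Real.exp (-(δ * distU n M i.1 j.1))) :
    SchemaS (fun b : Bnd n M => ucPt M n b.1) (hcoefS n M M₀) (ctr M M₀) (fun i j => Lloc n M a i j) (fun i j => kmat n M i j)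
      (Dgs n M) (2 / 3 * M₀) (Lw d / M₀) ((2 * d * Lw d + d * K2 + 4 * |a| * Lw d) / M₀) 4 (C * ((n : ℝ) ^ d)⁻¹) δ
      (d * ((n : ℝ) ^ d * (Real.exp (2 * (δ / 8)) * B4Sect5Proof.latticeConst d (δ / 8)))) where
  abs_le := fun z b => abs_hcoefS_le_one z b
  supp := fun z b h => dist_ctr_le_of_hz_ne_zero M hM₀ h
  lip := fun z b b' => abs_hz_sub_le M hM₀ z _ _
  lip_nonneg := div_nonneg (Lw_nonneg d) (Nat.cast_nonneg _)
  range := by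
    intro i j hfar
    show Lloc n M a i j = 0
    by_contra hne
    have h4 := distU_le_of_Lloc_ne_zero hn hne
    rw [dist_ucPt_eq_distU hn] at hfar
    linarith
  local_norm := fun z v => local_normP_holds hn hM₀ z v
  loc_nonneg := by
    have := Lw_nonneg d
    have := K2_nonneg
    positivity
  decay := fun i j => by
    show |kmat n M i j| ≤ _
    rw [dist_ucPt_eq_distU hn]
    exact (abs_kmat_le i j).trans (hV i j)
  C_nonneg := by positivity
  δ_pos := hδ
  rowsum := fun b => rowsum_plain_le hn (by positivity) b

/-- `Δ_a` on the carrier of record splits as local part + kernel part: `DAs = kerOpS (Δ + aQ*Q) + kerOpS (−re ∂P∂*)`.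
[cite: Balaban1984PropagatorsI, (1.69) p.29, (1.121) p.37] -/
theorem DAs_eq_split : DAs n M a = kerOpS (fun i j => Lloc n M a i j) + kerOpS (fun i j => kmat n M i j) :=
  DAs_eq_kerOpS_add fun i j => by rw [DeltaAR_eq_Lloc_add_kmat, Matrix.add_apply]

/-- **THE FIELD `h128` OF `B5SupWalkS1.Rep` FOR THE OPERATORS OF RECORD ON THE SUP CARRIER OF RECORD** («|h_{z₁}K(h_{z₂})A| ≤
O(M₀⁻¹)e^{−2δ₀|z₁−z₂|}(|∇A| + |A|). (1.128)», `2δ₀ = min{⅓δ′₀, M₀⁻¹}`): given the (1.126)-type bound ‖(∂P∂*)_{ij}‖ ≤ Cη^d e^{−δ|x_i−x_j|},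
for all centres `z₁ z₂` and all vector fields `v`, `‖h_{z₁}K(h_{z₂})v‖_∞ ≤ (thetaW d a δ C/M₀)·e^{−twoDelta0 δ M₀·dist(ctr z₁, ctr z₂)}·(‖∇v‖_∞ +
‖v‖_∞)`, uniformly in `η`, the volume and `M₀ ≥ 1`. [cite: Balaban1984PropagatorsI, (1.128) p.38, (1.121) p.37, (1.126) p.38] -/
theorem h128P_holds (hn : 1 ≤ n) {M₀ : ℕ} (hM₀ : 1 ≤ M₀) {δ C : ℝ} (hδ : 0 < δ) (hC : 0 ≤ C)
    (hV : ∀ i j : Bnd n M, ‖VC n M i j‖ ≤ C * ((n : ℝ) ^ d)⁻¹ * Real.exp (-(δ * distU n M i.1 j.1)))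
    (z₁ z₂ : Cen M M₀) (v : VecR n M) :
    ‖Hs n M M₀ z₁ (Kop (DAs n M a) (Hs n M M₀) z₂ v)‖
      ≤ thetaW d a δ C / M₀ * Real.exp (-(twoDelta0 δ M₀ * dist (ctr M M₀ z₁) (ctr M M₀ z₂))) * (‖Dgs n M v‖ + ‖v‖) := by
  have hM0 : (0 : ℝ) < M₀ := by exact_mod_cast hM₀
  have hM1 : (1 : ℝ) ≤ M₀ := by exact_mod_cast hM₀
  have hn0 : ((n : ℝ) ^ d) ≠ 0 := pow_ne_zero _ (Nat.cast_ne_zero.mpr (NeZero.ne n))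
  have hs : 2 / 3 * (M₀ : ℝ) ≤ 2 * M₀ := by linarith
  have hS := schemaP_holds (a := a) hn hM₀ hδ hC hV
  have h := h128_schemaS hS hM0 hs z₁ z₂ v
  have eH : (Hs n M M₀) = fun z => mulOpS (hcoefS n M M₀ z) := rfl
  rw [Hs_eq, DAs_eq_split, eH]
  refine h.trans ?_
  have hE : 0 ≤ Real.exp (-(twoDelta0 δ M₀ * dist (ctr M M₀ z₁) (ctr M M₀ z₂))) := (Real.exp_pos _).le
  have hN : 0 ≤ ‖Dgs n M v‖ + ‖v‖ := by positivity
  refine mul_le_mul_of_nonneg_right (mul_le_mul_of_nonneg_right ?_ hE) hN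
  -- the constant is `≤ thetaW/M₀`: p38's arithmetic, plus `d·(…) ≤ |Gr d|·(d·(…))` since `1 ≤ |Gr d|`
  have hLw := Lw_nonneg d
  have hK2 := K2_nonneg
  have hK := B4Sect5Proof.latticeConst_nonneg d (le_of_lt (by positivity : (0 : ℝ) < δ / 8))
  have hGr : (1 : ℝ) ≤ Fintype.card (Gr d) := by
    have : 0 < Fintype.card (Gr d) := Fintype.card_pos_iff.mpr ⟨Sum.inl ()⟩
    exact_mod_cast this
  have h1 : (2 * d * Lw d + d * K2 + 4 * |a| * Lw d) / M₀ * Real.exp (4 + 4 / M₀)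
      ≤ (2 * d * Lw d + d * K2 + 4 * |a| * Lw d) * Real.exp 8 / M₀ := by
    rw [div_mul_eq_mul_div]
    refine div_le_div_of_nonneg_right (mul_le_mul_of_nonneg_left (Real.exp_le_exp.mpr ?_) (by positivity)) hM0.le
    have : 4 / (M₀ : ℝ) ≤ 4 := div_le_self (by norm_num) hM1
    linarith
  have h2 : Lw d / M₀ * (C * ((n : ℝ) ^ d)⁻¹) * (24 / (Real.exp 1 * δ))
        * (d * ((n : ℝ) ^ d * (Real.exp (2 * (δ / 8)) * B4Sect5Proof.latticeConst d (δ / 8)))) * Real.exp 7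
      = Lw d * C * (24 / (Real.exp 1 * δ)) * (d * (Real.exp (2 * (δ / 8)) * B4Sect5Proof.latticeConst d (δ / 8)))
        * Real.exp 7 / M₀ := by
    field_simp
  have h3 : Lw d * C * (24 / (Real.exp 1 * δ)) * (d * (Real.exp (2 * (δ / 8)) * B4Sect5Proof.latticeConst d (δ / 8)))
        * Real.exp 7 / M₀
      ≤ Lw d * C * (24 / (Real.exp 1 * δ))
        * (Fintype.card (Gr d) * (d * (Real.exp (2 * (δ / 8)) * B4Sect5Proof.latticeConst d (δ / 8)))) * Real.exp 7 / M₀ := by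
    refine div_le_div_of_nonneg_right (mul_le_mul_of_nonneg_right (mul_le_mul_of_nonneg_left ?_ (by positivity))
      (Real.exp_pos _).le) hM0.le
    have h0 : 0 ≤ (d * (Real.exp (2 * (δ / 8)) * B4Sect5Proof.latticeConst d (δ / 8)) : ℝ) := by positivity
    calc (d * (Real.exp (2 * (δ / 8)) * B4Sect5Proof.latticeConst d (δ / 8)) : ℝ)
        = 1 * (d * (Real.exp (2 * (δ / 8)) * B4Sect5Proof.latticeConst d (δ / 8))) := (one_mul _).symm
      _ ≤ Fintype.card (Gr d) * (d * (Real.exp (2 * (δ / 8)) * B4Sect5Proof.latticeConst d (δ / 8))) :=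
          mul_le_mul_of_nonneg_right hGr h0
  rw [h2, thetaW]
  calc _ ≤ (2 * d * Lw d + d * K2 + 4 * |a| * Lw d) * Real.exp 8 / M₀
        + Lw d * C * (24 / (Real.exp 1 * δ))
          * (Fintype.card (Gr d) * (d * (Real.exp (2 * (δ / 8)) * B4Sect5Proof.latticeConst d (δ / 8)))) * Real.exp 7 / M₀ :=
        add_le_add h1 h3
    _ = _ := by rw [← add_div]

end H128

/-! ## §4 The direct representation of record -/

section RepOfRecord

/-- **the (1.128)-constant as a TOTAL function of the (1.126) constants** (a `thetaBar` slot for `SupConsts`):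
`thetaBarS d a δ C := thetaW d a |δ| (|C| + 1)` — nonnegative for all real `δ, C` and dominating `thetaW d a δ C` on `δ > 0`, `C ≥ 0`;
the geometric and certificate slots of `SupConsts` (`cbar, nu, Kbar, cF, cL, c1`) are fixed by the certificate files of the programme,
which is why `repS` below is generic in `κ`. [cite: Balaban1984PropagatorsI, (1.128) p.38 («O(M₀⁻¹)»), p.39 («we can fix M₀ depending on
d only»)] -/
def thetaBarS (d : ℕ) (a : ℝ) : ℝ → ℝ → ℝ := fun δ C => thetaW d a |δ| (|C| + 1)

/-- `0 ≤ thetaBarS d a δ C` for all `δ, C` (the shape of the field `thetaBar_nonneg` of `SupConsts`). [cite: Balaban1984PropagatorsI, (1.128) p.38] -/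
theorem thetaBarS_nonneg (d : ℕ) (a δ C : ℝ) : 0 ≤ thetaBarS d a δ C := by
  unfold thetaBarS
  rcases eq_or_ne δ 0 with h0 | h0
  · subst h0
    unfold thetaW
    have := Lw_nonneg d
    have := K2_nonneg
    simp only [abs_zero, mul_zero, div_zero, zero_mul, add_zero]
    positivity
  · exact thetaW_nonneg d a (abs_pos.mpr h0) (by positivity)

/-- `thetaW` is monotone in its constant `C ≥ 0` (affine in `C` with a nonnegative slope), hence `thetaW d a δ C ≤ thetaBarS d a δ C` on
`δ > 0`, `C ≥ 0` — the domination hypothesis `hθ` of `repS` for any `κ` with `κ.thetaBar = thetaBarS d a`.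
[cite: Balaban1984PropagatorsI, (1.128) p.38 («O(M₀⁻¹)»)] -/
theorem thetaW_le_thetaBarS (d : ℕ) (a : ℝ) {δ C : ℝ} (hδ : 0 < δ) (hC : 0 ≤ C) : thetaW d a δ C ≤ thetaBarS d a δ C := by
  unfold thetaBarS
  rw [abs_of_pos hδ, abs_of_nonneg hC]
  unfold thetaW
  have hLw := Lw_nonneg d
  have hK := B4Sect5Proof.latticeConst_nonneg d (le_of_lt (by positivity : (0 : ℝ) < δ / 8))
  have hslope : 0 ≤ Lw d * (24 / (Real.exp 1 * δ))
      * (Fintype.card (Gr d) * (d * (Real.exp (2 * (δ / 8)) * B4Sect5Proof.latticeConst d (δ / 8)))) * Real.exp 7 := by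
    positivity
  nlinarith

variable (n : ℕ) [NeZero n] (M : Fin d → ℕ) [hM : ∀ μ, NeZero (M μ)] (a : ℝ) (k : ℕ) (M₀ : ℕ)

/-- **THE DIRECT SUP REPRESENTATION OF RECORD** — `B5SupWalkS1.Rep` INHABITED for `G = Δ_a⁻¹` on `T_η × {1..d}` (`T_η = Tor (fine n M)`,
`η = 1/n`), every `n ≥ 1`, torus `M`, `a > 0`, `k`, cube scale `M₀ ≥ 1`, and every family of uniform constants `κ` with
`thetaW d a ≤ κ.thetaBar` (pointwise on `δ > 0`, `C ≥ 0`) and `1 ≤ κ.cG`: carrier = real vector fields with the sup norm (1.108) and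
`G = Gs`, `Δ_a = DAs`, `h_z = Hs z`, `∇ = Dgs`, centres `(M₀ℤ)^d ∩ T` — all of p38 gen 8's `B5SupCarrierTorus`, whose theorems give the
fields (1.118), (1.71), `|h_zA| ≤ |A|` and (1.115)-read-on-the-carrier; the field (1.126) ⇒ (1.128) is `h128P_holds` ∘ p38's
`entry_le_of_kdW`. [cite: Balaban1984PropagatorsI, (1.71) p.30, (1.115), (1.118) p.36, (1.123) p.37, (1.128) p.38, p.39] -/
def repS (hn : 1 ≤ n) (ha : 0 < a) (hM₀ : 1 ≤ M₀) (κ : SupConsts)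
    (hθ : ∀ δ C : ℝ, 0 < δ → 0 ≤ C → thetaW d a δ C ≤ κ.thetaBar δ C) (hcG : 1 ≤ κ.cG) :
    Rep (latticeSettingP12R n M a k) (kdW n M) (gP12R M n a k) M₀ κ (VecR n M) (Fin d → VecR n M) (TorR M) (Cen M M₀)
      (ctr M M₀) where
  G := Gs n M a
  Δa := DAs n M a
  H := Hs n M M₀
  Dg := Dgs n M
  h118 := h118S
  h71 := DAs_mul_Gs hn ha
  h71' := Gs_mul_DAs hn ha
  normH := norm_Hs_le
  h115 := fun C Cα Cε Cαε hC hG => h115S_holds k hn hcG C Cα Cε Cαε hC hG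
  h128 := fun δ C hδ hC hker z₁ z₂ A => by
    have hV := entry_le_of_kdW hker
    have h := h128P_holds (a := a) hn hM₀ hδ hC.le hV z₁ z₂ A
    have hM0 : (0 : ℝ) < M₀ := by exact_mod_cast hM₀
    have hE : 0 ≤ Real.exp (-(twoDelta0 δ M₀ * dist (ctr M M₀ z₁) (ctr M M₀ z₂))) := (Real.exp_pos _).le
    have hN : 0 ≤ ‖Dgs n M A‖ + ‖A‖ := by positivity
    refine h.trans (mul_le_mul_of_nonneg_right (mul_le_mul_of_nonneg_right ?_ hE) hN)
    exact div_le_div_of_nonneg_right (hθ δ C hδ hC.le) hM0.le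

/-- **`repS` at `κ.thetaBar = thetaBarS d a`**: the domination hypothesis discharged by `thetaW_le_thetaBarS` (any `κ` agreeing with
`thetaBarS d a` on its `thetaBar` slot and with `1 ≤ κ.cG`). [cite: Balaban1984PropagatorsI, (1.128) p.38, p.39] -/
def repS_thetaBarS (hn : 1 ≤ n) (ha : 0 < a) (hM₀ : 1 ≤ M₀) (κ : SupConsts) (hκ : κ.thetaBar = thetaBarS d a)
    (hcG : 1 ≤ κ.cG) :
    Rep (latticeSettingP12R n M a k) (kdW n M) (gP12R M n a k) M₀ κ (VecR n M) (Fin d → VecR n M) (TorR M) (Cen M M₀)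
      (ctr M M₀) :=
  repS n M a k M₀ hn ha hM₀ κ (fun δ C hδ hC => by rw [hκ]; exact thetaW_le_thetaBarS d a hδ hC) hcG

end RepOfRecord

end

end Literature.MathematicalPhysics.QuantumFieldTheory.Balaban1983to89.B5SupRepTorus
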